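import Mathlib.Analysis.Calculus.ParametricIntegral
import Mathlib.Analysis.Calculus.ContDiff.FiniteDimension
import Mathlib.MeasureTheory.Integral.DominatedConvergence
import Mathlib.MeasureTheory.Integral.Bochner.ContinuousLinearMap
import HarnessLib

/-!
# Smooth dependence on parameters of integrals against a finite measure

Analysis/FunctionSpaces support file, companion of `SmoothParametricIntegral.lean` (which treats
integrals over a compact interval). Here the integration variable ranges over a measurable space
`W` with a finite measure `μ`, enters the integrand through a measurable map `ι : W → V` into a
normed space taking values a.e. in a compact set `K`, and the integrand `G : V × P → F` is smooth
jointly in `(y, p)`; the conclusion is that `p ↦ ∫ G (ι w, p) dμ(w)` is smooth, with the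
derivative computed under the integral sign. Typical instances: averages over the unit sphere
(`W = S^{d-1}`, `ι` the inclusion, `μ` the surface measure) and integrals over balls
(`μ = volume.restrict (closedBall 0 R)`, `ι = id`, `K` the ball), as they occur in collision
operators of kinetic theory. Everything is proved; theorems only.

* `continuous_parametric_integral`, `hasFDerivAt_parametric_integral` (Mathlib's
  `hasFDerivAt_integral_of_dominated_of_fderiv_le` with the constant bound from continuity of
  `DG` on `K × closedBall p₀ 1`), `fderiv_parametric_integral_apply`,
  `differentiable_parametric_integral`, `contDiff_nat_parametric_integral` (induction on the
  order: directional derivatives are parametric integrals of `(y, p) ↦ D G (y, p) (0, v)`),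
  `contDiff_parametric_integral`.

## References

* L. Hörmander, *The Analysis of Linear Partial Differential Operators I*, 2nd ed. (1990),
  Thm. 1.1.7–1.1.9 (differentiation under the integral sign).
* L. C. Evans, *Partial Differential Equations*, 2nd ed. (2010), App. C.
-/

noncomputable section

open MeasureTheory Set Filter Topology Metric
open scoped ContDiff

namespace Literature.Analysis.FunctionSpaces

variable {W : Type*} [MeasurableSpace W] {μ : Measure W}
variable {V : Type*} [NormedAddCommGroup V] [NormedSpace ℝ V] [SecondCountableTopology V]
  [MeasurableSpace V] [BorelSpace V]
variable {P : Type*} [NormedAddCommGroup P] [NormedSpace ℝ P] [FiniteDimensional ℝ P]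
variable {F : Type*} [NormedAddCommGroup F] [NormedSpace ℝ F]

omit [FiniteDimensional ℝ P] [SecondCountableTopology V] [MeasurableSpace V] [BorelSpace V] in
/-- The partial derivative in the parameter of `G : V × P → F` at `(y, p)`, as a continuous linear
map: `D G (y, p) ∘ (0, ·)`. [folklore] -/
theorem hasFDerivAt_comp_prodMk_right {G : V × P → F} {n : WithTop ℕ∞} (hG : ContDiff ℝ n G)
    (hn : n ≠ 0) (y : V) (p : P) :
    HasFDerivAt (fun q : P => G (y, q)) ((fderiv ℝ G (y, p)).comp (ContinuousLinearMap.inr ℝ V P)) p := by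
  have h1 : HasFDerivAt G (fderiv ℝ G (y, p)) (y, p) := ((hG.differentiable hn) (y, p)).hasFDerivAt
  have h2 : HasFDerivAt (fun q : P => ((y, q) : V × P)) (ContinuousLinearMap.inr ℝ V P) p :=
    (hasFDerivAt_const y p).prodMk (hasFDerivAt_id p)
  exact h1.comp p h2

omit [FiniteDimensional ℝ P] [NormedSpace ℝ V] [NormedSpace ℝ P] in
/-- Measurability of the sections `w ↦ G (ι w, p)`. [folklore] -/
theorem aestronglyMeasurable_comp_section {ι : W → V} (hι : Measurable ι) {X : Type*}
    [TopologicalSpace X] [TopologicalSpace.PseudoMetrizableSpace X] {G : V × P → X}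
    (hG : Continuous G) (p : P) (ν : Measure W) :
    AEStronglyMeasurable (fun w => G (ι w, p)) ν :=
  (hG.comp (Continuous.prodMk_left p)).comp_aestronglyMeasurable hι.aestronglyMeasurable

variable [IsFiniteMeasure μ]

omit [FiniteDimensional ℝ P] [NormedSpace ℝ V] [NormedSpace ℝ P] in
/-- **Continuity of parametric integrals against a finite measure concentrated on a compact set.**
If `G : V × P → F` is continuous and `ι : W → V` is measurable with values a.e. in a compact `K`,
then `p ↦ ∫ G (ι w, p) dμ` is continuous (dominated convergence with a constant bound on
`K × closedBall p₀ 1`; `P` locally compact is not needed for this step but is assumed below).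
[folklore] -/
theorem continuous_parametric_integral [LocallyCompactSpace P] {ι : W → V} (hι : Measurable ι)
    {K : Set V} (hK : IsCompact K) (hιK : ∀ᵐ w ∂μ, ι w ∈ K) {G : V × P → F} (hG : Continuous G) :
    Continuous fun p : P => ∫ w, G (ι w, p) ∂μ := by
  refine continuous_iff_continuousAt.2 fun p₀ => ?_
  obtain ⟨L, hLc, hLp⟩ := exists_compact_mem_nhds p₀
  obtain ⟨C, hC⟩ : ∃ C, ∀ q ∈ K ×ˢ L, ‖G q‖ ≤ C :=
    (hK.prod hLc).exists_bound_of_continuousOn hG.continuousOn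
  refine continuousAt_of_dominated (bound := fun _ => C) ?_ ?_ (integrable_const C) ?_
  · exact Eventually.of_forall fun p => aestronglyMeasurable_comp_section hι hG p μ
  · filter_upwards [hLp] with p hp
    exact hιK.mono fun w hw => hC _ ⟨hw, hp⟩
  · exact Eventually.of_forall fun w => (hG.comp (Continuous.prodMk_right (ι w))).continuousAt

/-- **One derivative under the integral sign.** If `G : V × P → F` is `C¹`, `ι : W → V` is
measurable with values a.e. in a compact `K` and `μ` is finite, then `p ↦ ∫ G (ι w, p) dμ` has
derivative `∫ D G (ι w, p) ∘ (0, ·) dμ` (Mathlib's `hasFDerivAt_integral_of_dominated_of_fderiv_le`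
with the constant bound from continuity of `DG` on `K × closedBall p₀ 1`). [folklore] -/
theorem hasFDerivAt_parametric_integral {ι : W → V} (hι : Measurable ι)
    {K : Set V} (hK : IsCompact K) (hιK : ∀ᵐ w ∂μ, ι w ∈ K) {G : V × P → F} {n : WithTop ℕ∞}
    (hG : ContDiff ℝ n G) (hn : n ≠ 0) (p₀ : P) :
    HasFDerivAt (fun p : P => ∫ w, G (ι w, p) ∂μ)
      (∫ w, (fderiv ℝ G (ι w, p₀)).comp (ContinuousLinearMap.inr ℝ V P) ∂μ) p₀ := by
  have hGc : Continuous G := hG.continuous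
  have hDc : Continuous (fderiv ℝ G) := hG.continuous_fderiv hn
  set F' : P → W → P →L[ℝ] F :=
    fun p w => (fderiv ℝ G (ι w, p)).comp (ContinuousLinearMap.inr ℝ V P) with hF'
  -- the derivative family as a continuous function of `(y, p)` composed with `ι`
  set D : V × P → P →L[ℝ] F := fun q => (fderiv ℝ G q).comp (ContinuousLinearMap.inr ℝ V P) with hD
  have hDcont : Continuous D :=
    ((ContinuousLinearMap.compL ℝ P (V × P) F).flip (ContinuousLinearMap.inr ℝ V P)).continuous.comp hDc
  obtain ⟨C, hC⟩ : ∃ C, ∀ q ∈ K ×ˢ closedBall p₀ 1, ‖D q‖ ≤ C :=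
    (hK.prod (isCompact_closedBall p₀ 1)).exists_bound_of_continuousOn hDcont.continuousOn
  obtain ⟨C₀, hC₀⟩ : ∃ C₀, ∀ q ∈ K ×ˢ closedBall p₀ 1, ‖G q‖ ≤ C₀ :=
    (hK.prod (isCompact_closedBall p₀ 1)).exists_bound_of_continuousOn hGc.continuousOn
  refine hasFDerivAt_integral_of_dominated_of_fderiv_le (F := fun p w => G (ι w, p)) (F' := F')
    (bound := fun _ => C) (ball_mem_nhds p₀ one_pos) ?_ ?_ ?_ ?_ (integrable_const C) ?_
  · exact Eventually.of_forall fun p => aestronglyMeasurable_comp_section hι hGc p μ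
  · refine Integrable.mono' (integrable_const C₀) (aestronglyMeasurable_comp_section hι hGc p₀ μ) ?_
    exact hιK.mono fun w hw => hC₀ _ ⟨hw, mem_closedBall_self zero_le_one⟩
  · exact aestronglyMeasurable_comp_section hι hDcont p₀ μ
  · refine hιK.mono fun w hw p hp => ?_
    exact hC (ι w, p) ⟨hw, mem_closedBall.2 (le_of_lt (mem_ball.1 hp))⟩
  · exact Eventually.of_forall fun w p _ => hasFDerivAt_comp_prodMk_right hG hn (ι w) p

/-- The derivative of `p ↦ ∫ G (ι w, p) dμ` in the direction `v` is the parametric integral of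
the smooth function `(y, p) ↦ D G (y, p) (0, v)`. [folklore] -/
theorem fderiv_parametric_integral_apply {ι : W → V} (hι : Measurable ι)
    {K : Set V} (hK : IsCompact K) (hιK : ∀ᵐ w ∂μ, ι w ∈ K) {G : V × P → F} {n : WithTop ℕ∞}
    (hG : ContDiff ℝ n G) (hn : n ≠ 0) (p : P) (v : P) :
    fderiv ℝ (fun p : P => ∫ w, G (ι w, p) ∂μ) p v = ∫ w, fderiv ℝ G (ι w, p) ((0 : V), v) ∂μ := by
  rw [(hasFDerivAt_parametric_integral hι hK hιK hG hn p).fderiv]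
  have hDc : Continuous (fderiv ℝ G) := hG.continuous_fderiv hn
  have hDcont : Continuous fun q : V × P => (fderiv ℝ G q).comp (ContinuousLinearMap.inr ℝ V P) :=
    ((ContinuousLinearMap.compL ℝ P (V × P) F).flip (ContinuousLinearMap.inr ℝ V P)).continuous.comp hDc
  obtain ⟨C, hC⟩ : ∃ C, ∀ q ∈ K ×ˢ closedBall p 1, ‖(fderiv ℝ G q).comp (ContinuousLinearMap.inr ℝ V P)‖ ≤ C :=
    (hK.prod (isCompact_closedBall p 1)).exists_bound_of_continuousOn hDcont.continuousOn
  have hint : Integrable (fun w => (fderiv ℝ G (ι w, p)).comp (ContinuousLinearMap.inr ℝ V P)) μ := by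
    refine Integrable.mono' (integrable_const C) (aestronglyMeasurable_comp_section hι hDcont p μ) ?_
    exact hιK.mono fun w hw => hC _ ⟨hw, mem_closedBall_self zero_le_one⟩
  rw [ContinuousLinearMap.integral_apply hint]
  rfl

/-- `p ↦ ∫ G (ι w, p) dμ` is differentiable for `C¹` integrands. [folklore] -/
theorem differentiable_parametric_integral {ι : W → V} (hι : Measurable ι)
    {K : Set V} (hK : IsCompact K) (hιK : ∀ᵐ w ∂μ, ι w ∈ K) {G : V × P → F} {n : WithTop ℕ∞}
    (hG : ContDiff ℝ n G) (hn : n ≠ 0) : Differentiable ℝ fun p : P => ∫ w, G (ι w, p) ∂μ :=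
  fun p => (hasFDerivAt_parametric_integral hι hK hιK hG hn p).differentiableAt

/-- `C^n` regularity of parametric integrals of smooth integrands, every `n : ℕ`. [folklore] -/
theorem contDiff_nat_parametric_integral {ι : W → V} (hι : Measurable ι)
    {K : Set V} (hK : IsCompact K) (hιK : ∀ᵐ w ∂μ, ι w ∈ K) :
    ∀ (n : ℕ) {G : V × P → F}, ContDiff ℝ ∞ G → ContDiff ℝ n fun p : P => ∫ w, G (ι w, p) ∂μ
  | 0, G, hG => by
    rw [Nat.cast_zero, contDiff_zero]
    exact continuous_parametric_integral hι hK hιK hG.continuous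
  | n + 1, G, hG => by
    have h1 : (∞ : WithTop ℕ∞) ≠ 0 := by exact_mod_cast WithTop.coe_ne_zero.2 (by decide)
    rw [Nat.cast_succ, contDiff_succ_iff_fderiv_apply]
    refine ⟨differentiable_parametric_integral hι hK hιK hG h1, fun h => ?_, fun v => ?_⟩
    · exact absurd h (by exact_mod_cast WithTop.coe_ne_top)
    · have hv : (fun p : P => fderiv ℝ (fun p : P => ∫ w, G (ι w, p) ∂μ) p v) =
          fun p : P => ∫ w, fderiv ℝ G (ι w, p) ((0 : V), v) ∂μ :=
        funext fun p => fderiv_parametric_integral_apply hι hK hιK hG h1 p v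
      rw [hv]
      refine contDiff_nat_parametric_integral hι hK hιK n (G := fun q => fderiv ℝ G q ((0 : V), v)) ?_
      exact (hG.fderiv_right (m := ∞) le_rfl).clm_apply contDiff_const

/-- **Smooth dependence on parameters of integrals against a finite measure concentrated on a
compact set.** If `G : V × P → F` is `C^∞` (`P` finite dimensional), `ι : W → V` is measurable
with values a.e. in a compact `K ⊆ V` and `μ` is a finite measure on `W`, then
`p ↦ ∫ G (ι w, p) dμ(w)` is `C^∞` (iterated differentiation under the integral sign; Hörmander,
Thm. 1.1.9). Typical instances: sphere averages (`W = S^{d-1}`, `ι` the inclusion, `μ` the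
surface measure) and integrals over balls (`μ = volume.restrict (closedBall 0 R)`, `ι = id`).
[folklore] -/
theorem contDiff_parametric_integral {ι : W → V} (hι : Measurable ι)
    {K : Set V} (hK : IsCompact K) (hιK : ∀ᵐ w ∂μ, ι w ∈ K) {G : V × P → F} (hG : ContDiff ℝ ∞ G) :
    ContDiff ℝ ∞ fun p : P => ∫ w, G (ι w, p) ∂μ :=
  contDiff_infty.2 fun n => contDiff_nat_parametric_integral hι hK hιK n hG

end Literature.Analysis.FunctionSpaces

end
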